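import Summits.ResolutionOfSingularities.ResolutionOfSingularities.Theorems.RadicialJungCleanModelsLens5TwistModel
import HarnessLib

/-!
# PORT (T-slice module map §16 (iii), part 2/2) of res-B-lens-5's `Cruxes/DescentPerfectToAll/Lens5_TwistModel.lean` rev 3 (405bacf54ae2)
# into `Theorems/` — the M-SIDE MODEL of THEOREM T: excellence / dimension of the twist model, `exists_twist_model`, and the F-32 call
# `monomialise_on_twist_model`

Author res-B-lens-5 (g9); ported verbatim by res-B-lead-1 g5.  OURS; nothing here proves resolution in characteristic `p`.
-/

noncomputable section

set_option linter.dupNamespace false -- mandated namespace of this single-conjunct summit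

open Literature.AlgebraicGeometry.Resolution

namespace Summit.ResolutionOfSingularities.ResolutionOfSingularities.Theorems.RadicialJung.CleanModels.Lens5.TwistModel

variable {k : Type} [Field k] {K : Type} [Field K] [Algebra k K]

/-- **Excellence of the M-side model** `T := A'_{centre}`: a local ring essentially of finite type over a field. -/
theorem isExcellentRing_localization_centre (M : IntermediateField k K) (O' : ValuationSubring M) (A' : Subalgebra k M)
    (h : A'.toSubring ≤ O'.toSubring) (hfg : A'.FG) :
    IsExcellentRing (Localization.AtPrime (centreIdeal A' O' h)) := by
  haveI : Algebra.FiniteType k A' := A'.fg_iff_finiteType.mp hfg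
  exact isExcellentRing_localization_atPrime (isExcellentRing_of_field k) (centreIdeal A' O' h)

/-- `K` is algebraic over a subfield containing all `p`-th powers (`p > 0`). -/
theorem isAlgebraic_of_pow_mem (M : IntermediateField k K) {p : ℕ} (hp : 0 < p) (hM : ∀ z : K, z ^ p ∈ M) :
    Algebra.IsAlgebraic M K := by
  constructor
  intro z
  apply IsIntegral.isAlgebraic
  apply IsIntegral.of_pow hp
  exact isIntegral_algebraMap (R := M) (x := ⟨z ^ p, hM z⟩)

/-- **Dimension of the M-side affine model**: a finitely generated `A' ⊇ k[S]` inside `M = k(S)`, with `K` algebraic over `M`, has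
`dim A' = dim A` (both are `trdeg_k K`). -/
theorem ringKrullDim_eq_of_adjoin_le (A : Subalgebra k K) (hAfg : A.FG) [IsFractionRing A K]
    (S : Set K) (halg : Algebra.IsAlgebraic (IntermediateField.adjoin k S) K)
    (A' : Subalgebra k (IntermediateField.adjoin k S))
    (hSA' : Algebra.adjoin k ((Subtype.val : IntermediateField.adjoin k S → K) ⁻¹' S) ≤ A') (hA'fg : A'.FG) :
    ringKrullDim A' = ringKrullDim A := by
  haveI : Algebra.FiniteType k A' := A'.fg_iff_finiteType.mp hA'fg
  haveI : Algebra.FiniteType k A := A.fg_iff_finiteType.mp hAfg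
  -- `Frac A' = k(S)`
  haveI hfr' : IsFractionRing A' (IntermediateField.adjoin k S) := by
    refine IsFractionRing.of_field _ _ (fun z => ?_)
    obtain ⟨r, hr, s, hs, hz⟩ := IntermediateField.mem_adjoin_iff_div.mp z.2
    have hrM : r ∈ IntermediateField.adjoin k S := IntermediateField.algebra_adjoin_le_adjoin k S hr
    have hsM : s ∈ IntermediateField.adjoin k S := IntermediateField.algebra_adjoin_le_adjoin k S hs
    refine ⟨⟨⟨r, hrM⟩, hSA' ((mem_adjoin_preimage_iff S _).mpr hr)⟩, ⟨⟨s, hsM⟩, hSA' ((mem_adjoin_preimage_iff S _).mpr hs)⟩, ?_⟩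
    apply Subtype.ext
    simpa using hz
  obtain ⟨s, hsA', htrA'⟩ := Literature.RingTheory.KrullDimension.exists_ringKrullDim_eq_and_trdeg_eq k A'
  obtain ⟨n, hnA, htrA⟩ := Literature.RingTheory.KrullDimension.exists_ringKrullDim_eq_and_trdeg_eq k A
  haveI : FaithfulSMul k A := (faithfulSMul_iff_algebraMap_injective k A).mpr (algebraMap k A).injective
  haveI : FaithfulSMul A K := (faithfulSMul_iff_algebraMap_injective A K).mpr (IsFractionRing.injective A K)
  haveI : Algebra.IsAlgebraic A K := IsLocalization.isAlgebraic K (nonZeroDivisors A)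
  haveI : FaithfulSMul k A' := (faithfulSMul_iff_algebraMap_injective k A').mpr (algebraMap k A').injective
  haveI : FaithfulSMul A' (IntermediateField.adjoin k S) :=
    (faithfulSMul_iff_algebraMap_injective A' _).mpr (IsFractionRing.injective A' (IntermediateField.adjoin k S))
  haveI : Algebra.IsAlgebraic A' (IntermediateField.adjoin k S) :=
    IsLocalization.isAlgebraic (IntermediateField.adjoin k S) (nonZeroDivisors A')
  haveI : FaithfulSMul (IntermediateField.adjoin k S) K :=
    (faithfulSMul_iff_algebraMap_injective _ K).mpr (algebraMap (IntermediateField.adjoin k S) K).injective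
  haveI := halg
  have htrK : Algebra.trdeg k K = (n : Cardinal) := by
    rw [← trdeg_add_eq k A (A := K), trdeg_eq_zero (R := A) (A := K), add_zero, htrA]
  have htrM : Algebra.trdeg k (IntermediateField.adjoin k S) = (n : Cardinal) := by
    rw [← htrK, ← trdeg_add_eq k (IntermediateField.adjoin k S) (A := K),
      trdeg_eq_zero (R := IntermediateField.adjoin k S) (A := K), add_zero]
  have htrA'' : Algebra.trdeg k A' = (n : Cardinal) := by
    rw [← htrM, ← trdeg_add_eq k A' (A := IntermediateField.adjoin k S),
      trdeg_eq_zero (R := A') (A := IntermediateField.adjoin k S), add_zero]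
  rw [htrA'] at htrA''
  have hsn : s = n := by exact_mod_cast htrA''
  rw [hsA', hnA, hsn]

/-- **The three side obligations of F-32 for the M-side model, assembled** (memo §2 INPUT 2 / §12): for `S ⊇ t^p` finite, `A = k[t]` an
affine model of `K` of dimension `3` with (hzd), and `A' ⊇ k[S]` the output of `exists_regular_model_subfield`: the centre of `O ∩ k(S)`
on `A'` is CLOSED, `T := A'_{centre}` is EXCELLENT and `dim T = 3`. -/
theorem model_side_obligations (p : ℕ) [Fact p.Prime] [CharP K p] (O : ValuationSubring K) (A : Subalgebra k K)
    (hAO : A.toSubring ≤ O.toSubring) (hAfg : A.FG) [IsFractionRing A K] (hdim : ringKrullDim A = 3)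
    (t : Set K) (ht : Algebra.adjoin k t = A)
    (hzd : ∀ (T : Subring K) (hT : T ≤ O.toSubring), A.toSubring ≤ T → (subringCentre T O hT).IsMaximal)
    (S : Set K) (htS : (fun x : K => x ^ p) '' t ⊆ S)
    (A' : Subalgebra k (IntermediateField.adjoin k S))
    (h : A'.toSubring ≤ (O.comap (algebraMap (IntermediateField.adjoin k S) K)).toSubring)
    (hSA' : Algebra.adjoin k ((Subtype.val : IntermediateField.adjoin k S → K) ⁻¹' S) ≤ A') (hA'fg : A'.FG) :
    (centreIdeal A' (O.comap (algebraMap (IntermediateField.adjoin k S) K)) h).IsMaximal ∧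
      IsExcellentRing (Localization.AtPrime (centreIdeal A' (O.comap (algebraMap (IntermediateField.adjoin k S) K)) h)) ∧
      ringKrullDim (Localization.AtPrime (centreIdeal A' (O.comap (algebraMap (IntermediateField.adjoin k S) K)) h)) = 3 := by
  have hp : 0 < p := (Fact.out : p.Prime).pos
  have htA' : ∀ a ∈ t, ∃ y ∈ A', algebraMap (IntermediateField.adjoin k S) K y = a ^ p := by
    intro a ha
    have haS : a ^ p ∈ S := htS ⟨a, ha, rfl⟩
    refine ⟨⟨a ^ p, IntermediateField.subset_adjoin k S haS⟩, hSA' (Algebra.subset_adjoin haS), rfl⟩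
  have hmax := centreIdeal_isMaximal_of_pow_generators O A hAO t ht hzd (IntermediateField.adjoin k S) A' h hp htA'
  refine ⟨hmax, isExcellentRing_localization_centre _ _ A' h hA'fg, ?_⟩
  haveI := hmax
  haveI : Algebra.FiniteType k A' := A'.fg_iff_finiteType.mp hA'fg
  have halg : Algebra.IsAlgebraic (IntermediateField.adjoin k S) K :=
    isAlgebraic_of_pow_mem _ hp (pow_mem_intermediateField_adjoin p A t ht S htS)
  rw [ringKrullDim_localization_atPrime_eq_of_isMaximal k (centreIdeal A' _ h),
    ringKrullDim_eq_of_adjoin_le A hAfg S halg A' hSA' hA'fg, hdim]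

/-! ## (rev 3) §2 in the PORT's convention: `R := locAtCentre A'.toSubring (O ∩ M) ⊆ ↥M`, `K := ↥M`, `E := K`, `O_E := O`

THEOREM P's port (`Theorems/RadicialJungCleanModelsCleanLU3Defectless.lean` :156–:195) calls F-32
`exists_localRing_monomial_of_embeddedResolution hEmb (R := S) (K := K) (E := K) Subtype.val_injective hexcS hdim3 O hRO hRm xR …` with
`S = locAtCentre A.toSubring O`.  For the T-slice the call is the same with `R := locAtCentre A'.toSubring (O.comap (algebraMap M K))`
(a subring of `↥M`, `M = k(S) = k·K^p(g₀)`), `K := ↥M`, `E := K`, `O_E := O`, under the composite algebra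
`letI : Algebra R K := ((algebraMap M K).comp R.subtype).toAlgebra` (scalar tower by `rfl`).  The theorems below deliver EVERY remaining
hypothesis of that call from the customer's data: regularity, excellence, dimension `3`, `hRO`, `hRm` (`locAtCentre_port_inputs`), packaged with
INPUT 1 in `exists_twist_model` (one statement: customer hypotheses + F-02·`.lu3` ⟹ the M-side model with all F-32 inputs); plus the two
bookkeeping facts the port meets first: `dim A = 3` from the stub's `dim A ≤ 3 ∧ dim A_centre = 3`, and `g₀` versus `g₀⁻¹` (one of them lies
in `O`; both generate the same field over `K^p`). -/

/-- `centreIdeal A' O' h` (Subalgebra form, `LocalUniformization.lean`) IS `subringCentre A'.toSubring O' h` (Subring form, `LocalBlowup.lean`). -/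
theorem centreIdeal_eq_subringCentre (M : IntermediateField k K) (O' : ValuationSubring M) (A' : Subalgebra k M)
    (h : A'.toSubring ≤ O'.toSubring) : centreIdeal A' O' h = subringCentre A'.toSubring O' h := rfl

/-- The restricted valuation ring `O ∩ M` measures values in `K`: for `y ∈ O ∩ M`, `v_{O∩M}(y) < 1 ↔ v_O(y) < 1`. -/
theorem valuation_comap_lt_one_iff (O : ValuationSubring K) (M : IntermediateField k K) (y : M)
    (hy : y ∈ O.comap (algebraMap M K)) :
    (O.comap (algebraMap M K)).valuation y < 1 ↔ O.valuation (algebraMap M K y) < 1 := by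
  have h1 := ValuationSubring.valuation_lt_one_iff (O.comap (algebraMap M K)) ⟨y, hy⟩
  have h2 := ValuationSubring.valuation_lt_one_iff O ⟨algebraMap M K y, ValuationSubring.mem_comap.mp hy⟩
  have h3 := mem_maximalIdeal_comap_iff O M ⟨y, hy⟩
  rw [← h1, h3, h2]

/-- `dim A = 3` from the stub's `dim A ≤ 3` and `dim (locAtCentre A O) = 3` (a localisation does not raise the dimension). -/
theorem ringKrullDim_eq_three_of_locAtCentre (O : ValuationSubring K) (A : Subalgebra k K) (hAO : A.toSubring ≤ O.toSubring)
    (hle : ringKrullDim A ≤ 3) (h3 : ringKrullDim (locAtCentre A.toSubring O) = 3) : ringKrullDim A = 3 := by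
  haveI := isLocalization_locAtCentre hAO
  refine le_antisymm hle ?_
  rw [← h3]
  exact Literature.RingTheory.KrullDimension.ringKrullDim_le_of_isLocalization
    (subringCentre A.toSubring O hAO).primeCompl (locAtCentre A.toSubring O)

/-- One of `g₀`, `g₀⁻¹` lies in `O`, and both generate the same field over any subfield data: `F(X ∪ {g⁻¹}) = F(X ∪ {g})` as subfields. -/
theorem subfield_closure_union_inv_eq (X : Set K) (g : K) : Subfield.closure (X ∪ {g⁻¹}) = Subfield.closure (X ∪ {g}) := by
  refine le_antisymm (Subfield.closure_le.mpr ?_) (Subfield.closure_le.mpr ?_)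
  · rintro x (hx | hx)
    · exact Subfield.subset_closure (Or.inl hx)
    · rw [Set.mem_singleton_iff.mp hx]
      exact inv_mem (Subfield.subset_closure (Or.inr rfl))
  · rintro x (hx | hx)
    · exact Subfield.subset_closure (Or.inl hx)
    · rw [Set.mem_singleton_iff.mp hx]
      have hg : g⁻¹ ∈ Subfield.closure (X ∪ {g⁻¹}) := Subfield.subset_closure (Or.inr rfl)
      simpa using inv_mem hg

/-- Either `g₀` or `g₀⁻¹` lies in the valuation ring `O`. [folklore] -/
theorem mem_or_inv_mem_valuationSubring (O : ValuationSubring K) (g₀ : K) : ∃ g₁ : K, g₁ ∈ O ∧ (g₁ = g₀ ∨ g₁ = g₀⁻¹) := by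
  rcases O.mem_or_inv_mem g₀ with h | h
  · exact ⟨g₀, h, Or.inl rfl⟩
  · exact ⟨g₀⁻¹, h, Or.inr rfl⟩

/-- **The F-32 inputs for the M-side model in the port's convention.**  For `A' ⊆ O ∩ M` finitely generated over `k` of dimension `3` whose
centre is closed and whose localisation at the centre is regular: `R := locAtCentre A'.toSubring (O ∩ M)` is a REGULAR local ring, EXCELLENT,
of dimension `3`, contained in `O` and DOMINATED by `O` (`r ∈ 𝔪_R ↔ v_O(r) < 1`, values read in `K`). -/
theorem locAtCentre_port_inputs (O : ValuationSubring K) (M : IntermediateField k K) (A' : Subalgebra k M)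
    (h : A'.toSubring ≤ (O.comap (algebraMap M K)).toSubring) (hA'fg : A'.FG)
    (hmax : (centreIdeal A' (O.comap (algebraMap M K)) h).IsMaximal)
    (hreg : IsRegularLocalRing (Localization.AtPrime (centreIdeal A' (O.comap (algebraMap M K)) h)))
    (hdimA' : ringKrullDim A' = 3) :
    ∃ _ : IsRegularLocalRing (locAtCentre A'.toSubring (O.comap (algebraMap M K))),
      IsExcellentRing (locAtCentre A'.toSubring (O.comap (algebraMap M K))) ∧
      ringKrullDim (locAtCentre A'.toSubring (O.comap (algebraMap M K))) = 3 ∧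
      (∀ r : locAtCentre A'.toSubring (O.comap (algebraMap M K)), algebraMap M K (r : M) ∈ O) ∧
      (∀ r : locAtCentre A'.toSubring (O.comap (algebraMap M K)),
        r ∈ IsLocalRing.maximalIdeal (locAtCentre A'.toSubring (O.comap (algebraMap M K))) ↔
          O.valuation (algebraMap M K (r : M)) < 1) := by
  have hreg' : IsRegularLocalRing (locAtCentre A'.toSubring (O.comap (algebraMap M K))) :=
    (isRegularLocalRing_locAtCentre_iff h).mpr hreg
  haveI := hreg'
  haveI := isLocalization_locAtCentre h
  haveI : Algebra.FiniteType k A' := A'.fg_iff_finiteType.mp hA'fg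
  have hexcA' : IsExcellentRing A' := isExcellentRing_of_finiteType_field k A'
  have hexc : IsExcellentRing (locAtCentre A'.toSubring (O.comap (algebraMap M K))) :=
    IsExcellentRing.of_isLocalization (A := A'.toSubring) (B := locAtCentre A'.toSubring (O.comap (algebraMap M K)))
      (subringCentre A'.toSubring (O.comap (algebraMap M K)) h).primeCompl hexcA'
  have hdim : ringKrullDim (locAtCentre A'.toSubring (O.comap (algebraMap M K))) = 3 := by
    rw [← ringKrullDim_eq_of_ringEquiv (locAtCentreEquiv h).toRingEquiv]
    haveI := hmax
    change ringKrullDim (Localization.AtPrime (centreIdeal A' (O.comap (algebraMap M K)) h)) = 3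
    rw [ringKrullDim_localization_atPrime_eq_of_isMaximal k (centreIdeal A' (O.comap (algebraMap M K)) h), hdimA']
  refine ⟨hreg', hexc, hdim, fun r => ValuationSubring.mem_comap.mp (locAtCentre_le h r.2), fun r => ?_⟩
  rw [mem_maximalIdeal_locAtCentre_iff h r]
  exact valuation_comap_lt_one_iff O M (r : M) (locAtCentre_le h r.2)

/-- **§2 of THEOREM T, assembled in the port's convention.**  Customer data — an affine model `A = k[t] ⊆ O` of `K` (`t` finite,
`Frac A = K`, `dim A = 3`; use `ringKrullDim_eq_three_of_locAtCentre`), the closed-centre hypothesis (hzd), an element `g₁ ∈ O` (`g₀` or `g₀⁻¹`,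
`mem_or_inv_mem_valuationSubring`) — together with F-02 via `.lu3` (`hLU : LocalUniformization3 k`) give, on the twist field `M := k(t^p ∪ {g₁})`
(`= k·K^p(g₀)` as a subfield: `adjoin_twist_toSubfield_eq` + `subfield_closure_union_inv_eq`; `= K^p(g₀)` for perfect `k`), a finitely generated
`A' ⊇ k[t^p, g₁]` inside `O ∩ M` such that `R := locAtCentre A'.toSubring (O ∩ M)` satisfies every hypothesis of F-32
`exists_localRing_monomial_of_embeddedResolution` with `K := ↥M`, `E := K`, `O_E := O`: regular local, excellent, `dim R = 3`, `R ⊆ O`, dominated. -/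
theorem exists_twist_model (p : ℕ) [Fact p.Prime] [CharP K p] (hLU : LocalUniformization3 k) (O : ValuationSubring K)
    (A : Subalgebra k K) (hAO : A.toSubring ≤ O.toSubring) (hAfg : A.FG) [IsFractionRing A K] (hdimA : ringKrullDim A = 3)
    (t : Finset K) (ht : Algebra.adjoin k (t : Set K) = A)
    (hzd : ∀ (T : Subring K) (hT : T ≤ O.toSubring), A.toSubring ≤ T → (subringCentre T O hT).IsMaximal)
    (g₁ : K) (hg₁ : g₁ ∈ O) (S : Set K) (hS : S = (fun x : K => x ^ p) '' (t : Set K) ∪ {g₁}) :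
    ∃ (A' : Subalgebra k (IntermediateField.adjoin k S)),
      A'.toSubring ≤ (O.comap (algebraMap (IntermediateField.adjoin k S) K)).toSubring ∧
      Algebra.adjoin k ((Subtype.val : IntermediateField.adjoin k S → K) ⁻¹' S) ≤ A' ∧ A'.FG ∧
      ∃ _ : IsRegularLocalRing (locAtCentre A'.toSubring (O.comap (algebraMap (IntermediateField.adjoin k S) K))),
        IsExcellentRing (locAtCentre A'.toSubring (O.comap (algebraMap (IntermediateField.adjoin k S) K))) ∧
        ringKrullDim (locAtCentre A'.toSubring (O.comap (algebraMap (IntermediateField.adjoin k S) K))) = 3 ∧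
        (∀ r : locAtCentre A'.toSubring (O.comap (algebraMap (IntermediateField.adjoin k S) K)),
          algebraMap (IntermediateField.adjoin k S) K (r : IntermediateField.adjoin k S) ∈ O) ∧
        (∀ r : locAtCentre A'.toSubring (O.comap (algebraMap (IntermediateField.adjoin k S) K)),
          r ∈ IsLocalRing.maximalIdeal _ ↔ O.valuation (algebraMap (IntermediateField.adjoin k S) K (r : IntermediateField.adjoin k S)) < 1) := by
  have hSfin : S.Finite := by
    rw [hS]
    exact ((t.finite_toSet).image _).union (Set.finite_singleton _)
  have hSO : ∀ s ∈ S, s ∈ O := by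
    intro s hs
    rw [hS] at hs
    rcases hs with ⟨a, ha, rfl⟩ | hs
    · have haA : a ∈ A := by rw [← ht]; exact Algebra.subset_adjoin ha
      exact (pow_mem (hAO haA) p : a ^ p ∈ O.toSubring)
    · rw [Set.mem_singleton_iff.mp hs]; exact hg₁
  have htS : (fun x : K => x ^ p) '' (t : Set K) ⊆ S := by rw [hS]; exact Set.subset_union_left
  obtain ⟨A', h, hSA', hA'fg, hreg⟩ := exists_regular_model_subfield hLU O A hAO hAfg inferInstance hdimA.le S hSfin hSO
  obtain ⟨hmax, -, -⟩ := model_side_obligations p O A hAO hAfg hdimA (t : Set K) ht hzd S htS A' h hSA' hA'fg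
  have hp : 0 < p := (Fact.out : p.Prime).pos
  have halg : Algebra.IsAlgebraic (IntermediateField.adjoin k S) K :=
    isAlgebraic_of_pow_mem _ hp (pow_mem_intermediateField_adjoin p A (t : Set K) ht S htS)
  have hdimA' : ringKrullDim A' = 3 := by rw [ringKrullDim_eq_of_adjoin_le A hAfg S halg A' hSA' hA'fg, hdimA]
  exact ⟨A', h, hSA', hA'fg, locAtCentre_port_inputs O _ A' h hA'fg hmax hreg hdimA'⟩

/-! ## (rev 3) THE F-32 CALL ITSELF on the M-side model (instance plumbing de-risked)

Under the composite algebra `R → ↥M → K` (supplied by the port as `letI : Algebra R K := ((algebraMap M K).comp R.subtype).toAlgebra` with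
`IsScalarTower R M K` by `IsScalarTower.of_algebraMap_eq fun _ => rfl`; taken here as instance hypotheses, so the statement stays def-free)
the F-32 entry `exists_localRing_monomial_of_embeddedResolution` applies VERBATIM with `K := ↥M`, `E := K`, `O_E := O` to any
`0 ≠ x_R ∈ 𝔪_R` of `R := locAtCentre A'.toSubring (O ∩ M)`: this is §2 INPUT 2 of THEOREM T (the element to monomialise, `x^p y^p ∏ τσ`,
comes from §1 and lies in `M`).  Universe `0` throughout (`Scheme.{0}` in `hEmb`, as in THEOREM P's port). -/

section F32Call

open AlgebraicGeometry CategoryTheory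

/-- **F-32 on the twist field.**  [cite: CossartJannsenSaito2020, Cor. 1.5, p. 7] (hypothesis `hEmb`, F-78 shape) -/
theorem monomialise_on_twist_model
    (hEmb : ∀ (Z : Scheme.{0}) [IsIntegral Z] [IsNoetherian Z], Scheme.IsRegular Z →
      Scheme.IsExcellent Z → ∀ (X : Set Z), IsClosed X → X ≠ Set.univ → topologicalKrullDim X ≤ 2 →
        ∃ (Z' : Scheme.{0}) (π : Z' ⟶ Z), IsProper π ∧ Function.Surjective π.base ∧
          (∃ U : Z.Opens, (U : Set Z) = Xᶜ ∧ IsIso (π ∣_ U)) ∧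
          IsStrictNormalCrossingsDivisor Z' (π.base ⁻¹' X))
    (O : ValuationSubring K) (M : IntermediateField k K) (A' : Subalgebra k M)
    (h : A'.toSubring ≤ (O.comap (algebraMap M K)).toSubring) (hA'fg : A'.FG)
    (hmax : (centreIdeal A' (O.comap (algebraMap M K)) h).IsMaximal)
    (hreg : IsRegularLocalRing (Localization.AtPrime (centreIdeal A' (O.comap (algebraMap M K)) h)))
    (hdimA' : ringKrullDim A' = 3)
    [Algebra (locAtCentre A'.toSubring (O.comap (algebraMap M K))) K]
    [IsScalarTower (locAtCentre A'.toSubring (O.comap (algebraMap M K))) M K]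
    (xR : locAtCentre A'.toSubring (O.comap (algebraMap M K))) (hxR0 : xR ≠ 0)
    (hxRm : O.valuation (algebraMap M K (xR : M)) < 1) :
    ∃ uu : Finset K, ((uu : Set K) ⊆ Set.range (algebraMap M K)) ∧
      (∀ y ∈ Algebra.adjoin (locAtCentre A'.toSubring (O.comap (algebraMap M K))) (uu : Set K), y ∈ O) ∧
      ∃ (R' : Type) (_ : CommRing R') (_ : IsRegularLocalRing R') (_ : Algebra R' K),
        Function.Injective (algebraMap R' K) ∧ (∀ r : R', algebraMap R' K r ∈ O) ∧
        (∀ r : R', r ∈ IsLocalRing.maximalIdeal R' ↔ O.valuation (algebraMap R' K r) < 1) ∧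
        (∀ y ∈ Algebra.adjoin (locAtCentre A'.toSubring (O.comap (algebraMap M K))) (uu : Set K),
          y ∈ Set.range (algebraMap R' K)) ∧
        (∀ r : R', ∃ τ σ : K, τ ∈ Algebra.adjoin (locAtCentre A'.toSubring (O.comap (algebraMap M K))) (uu : Set K) ∧
          σ ∈ Algebra.adjoin (locAtCentre A'.toSubring (O.comap (algebraMap M K))) (uu : Set K) ∧
          O.valuation σ = 1 ∧ algebraMap R' K r * σ = τ) ∧
        ∃ (d : ℕ) (z : Fin d → R') (α : Fin d → ℕ) (u : R'), IsUnit u ∧ ringKrullDim R' = d ∧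
          Ideal.span (Set.range z) = IsLocalRing.maximalIdeal R' ∧
          algebraMap (locAtCentre A'.toSubring (O.comap (algebraMap M K))) K xR = algebraMap R' K (u * ∏ i, z i ^ α i) := by
  obtain ⟨hreg', hexc, hdim, hRO, hRm⟩ := locAtCentre_port_inputs O M A' h hA'fg hmax hreg hdimA'
  haveI := hreg'
  have halg : ∀ r : locAtCentre A'.toSubring (O.comap (algebraMap M K)),
      algebraMap (locAtCentre A'.toSubring (O.comap (algebraMap M K))) K r = algebraMap M K (r : M) := fun r =>
    IsScalarTower.algebraMap_apply (locAtCentre A'.toSubring (O.comap (algebraMap M K))) M K r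
  have hRO' : ∀ r : locAtCentre A'.toSubring (O.comap (algebraMap M K)),
      algebraMap (locAtCentre A'.toSubring (O.comap (algebraMap M K))) K r ∈ O := fun r => by rw [halg]; exact hRO r
  have hRm' : ∀ r : locAtCentre A'.toSubring (O.comap (algebraMap M K)),
      r ∈ IsLocalRing.maximalIdeal _ ↔ O.valuation (algebraMap (locAtCentre A'.toSubring (O.comap (algebraMap M K))) K r) < 1 :=
    fun r => by rw [halg]; exact hRm r
  have hxRm' : xR ∈ IsLocalRing.maximalIdeal _ := (hRm xR).mpr hxRm
  exact exists_localRing_monomial_of_embeddedResolution hEmb (R := locAtCentre A'.toSubring (O.comap (algebraMap M K)))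
    (K := M) (E := K) Subtype.val_injective hexc hdim O hRO' hRm' xR hxR0 hxRm'

end F32Call


end Summit.ResolutionOfSingularities.ResolutionOfSingularities.Theorems.RadicialJung.CleanModels.Lens5.TwistModel

end
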